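import Summits.NavierStokesRegularity.NavierStokesRegularity.Theorems.AdaptedKernelExists.Negative.ComovingBridge
import Summits.NavierStokesRegularity.NavierStokesRegularity.Theorems.AdaptedKernelExists.Negative.SuperTypeIRate
import Literature.Analysis.FluidPDE.DriftHeatKernelLowerBound

/-!
# `AdaptedKernelExists` (stmt-NavierStokesRegularity-2956): comparability forces parabolic displacement — the rate is load-bearing, unconditionally

Negative / support lemmas for the crux `AdaptedFrequency.AdaptedKernelExists`, extracted from the
crux work file `Cruxes/AdaptedKernelExists/Disproof.lean` (cdisprove seat, cycle 2, §6, second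
half). No conclusion asserts a route item.

With the co-moving bridge (`ComovingBridge.isDriftHeatSolutionOn_comoving`), the tree's Gaussian
lower bound by earlier local mass (`IsDriftHeatSolutionOn.kernel_lower_bound`, Lieberman 1996
Ch. VI via Gaussian comparison, ZERO drift) transports the bulk that the LOWER comparability bound
puts near `x₀ + D(t′) e` (`t′ = (t+T)/2`) down to time `t`, where it lands at
`x₀ - (D(t) - D(t′)) e` and the UPPER comparability bound bites: `comparable_displacement_bound` —
`m₀ · exp((D(t) - D(t′))² ‖e‖² / (C₂ (T - t))) ≤ C₁` on every dyadic block,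
`m₀ = dispConst ν c₁ c₂ > 0`. COMPARABILITY OF AN ADAPTED KERNEL OF A UNIFORM DRIFT FORCES
PARABOLIC DYADIC DISPLACEMENT. Hence the super-Type-I member `a = (T - t)^{-3/4}`
(`SuperTypeIRate`; `D(t) - D(t′) ∝ (T - t)^{1/4}`) has NO comparable adapted kernel at all
(`super_no_comparable_adapted`), and the rate-free linear claim is FALSE UNCONDITIONALLY
(`linear_without_rate_false`) — no uniqueness theorem for adapted kernels is used (cycle 1's
`SuperTypeI.linear_without_rate_false_of_uniqueness` needed Widder uniqueness at the pole).
[folklore]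

## References

* G. M. Lieberman, *Second Order Parabolic Differential Equations*, World Scientific (1996),
  Ch. II Cor. 2.5, Ch. VI Thm 6.18 / Cor 6.24 (the comparison lower bound used through
  `IsDriftHeatSolutionOn.kernel_lower_bound`). [Lieberman1996]
-/

noncomputable section

namespace Summit.NavierStokesRegularity.NavierStokesRegularity.Theorems.AdaptedKernelExistsNegative.Comoving

open Set Filter Topology MeasureTheory Function
open scoped Laplacian InnerProductSpace RealInnerProductSpace ContDiff
open Literature.Analysis.FluidPDE Literature.Analysis

local notation "ℝ³" => EuclideanSpace ℝ (Fin 3)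

open UniformDrift SuperTypeI

section Displacement

open Metric

variable {ν t₀ T : ℝ} {x₀ e : ℝ³} {a D : ℝ → ℝ} {S : Set ℝ} {G : ℝ → ℝ³ → ℝ}

/-- The heat kernel at distance `d` tends to `0` as `d → ∞`. [folklore] -/
theorem tendsto_gaussTail_atTop (n : ℝ) {σ : ℝ} (hσ : 0 < σ) :
    Tendsto (fun d => gaussTail n d σ) atTop (𝓝 0) := by
  unfold gaussTail
  have h1 : Tendsto (fun d : ℝ => d ^ 2 / (4 * σ)) atTop atTop :=
    (tendsto_pow_atTop two_ne_zero).atTop_div_const (by positivity)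
  have h2 : Tendsto (fun d : ℝ => Real.exp (-d ^ 2 / (4 * σ))) atTop (𝓝 0) := by
    have := Real.tendsto_exp_atBot.comp (tendsto_neg_atTop_atBot.comp h1)
    refine this.congr fun d => ?_
    simp [neg_div]
  simpa using h2.const_mul ((4 * Real.pi * σ) ^ (-n / 2))

/-- Volume of the closed unit ball of `ℝ³` (a positive real). -/
def V₁ : ℝ := (volume : Measure ℝ³).real (closedBall (0 : ℝ³) 1)

/-- `V₁ > 0`. [folklore] -/
theorem V₁_pos : 0 < V₁ := by
  unfold V₁
  rw [measureReal_def]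
  exact ENNReal.toReal_pos (measure_closedBall_pos volume _ one_pos).ne'
    measure_closedBall_lt_top.ne

/-- The block constant `m₀ = c₁ e^{-1/c₂} (V₁/8) (2πν)^{-3/2} e^{-1/(4ν)}` of the displacement bound:
the mass the LOWER bound puts in the ball of radius `√(s/2)` about the pole at time `T - s/2`,
transported by the zero-drift lower kernel to age `νs`. -/
def dispConst (ν c₁ c₂ : ℝ) : ℝ :=
  c₁ * Real.exp (-(1 / c₂)) * (V₁ / 8) *
    ((2 * Real.pi * ν) ^ (-(3 : ℝ) / 2) * Real.exp (-(1 / (4 * ν))))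

/-- `dispConst ν c₁ c₂ > 0`. [folklore] -/
theorem dispConst_pos (hν : 0 < ν) {c₁ : ℝ} (hc₁ : 0 < c₁) (c₂ : ℝ) : 0 < dispConst ν c₁ c₂ := by
  unfold dispConst
  have := V₁_pos
  positivity

/-- **COMPARABILITY FORCES PARABOLIC DISPLACEMENT (uniform drifts).** Let `G` be an adapted kernel
of the uniform drift `a(t) e` on a time set `S ⊇ (t₀, T)` with pole `(T, x₀)`, and `D` a
displacement with `D' = -a` on `(t₀, T)`. If `G` obeys two-sided Gaussian bounds
`c₁ s^{-3/2} e^{-‖x - x₀‖²/(c₂ s)} ≤ G(t, x) ≤ C₁ s^{-3/2} e^{-‖x - x₀‖²/(C₂ s)}` (`s = T - t`) at the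
interior times, then on EVERY dyadic block
`m₀ · exp((D(t) - D((t+T)/2))² ‖e‖² / (C₂ (T - t))) ≤ C₁`, `m₀ = dispConst ν c₁ c₂ > 0`, i.e.
`|D(t) - D((t+T)/2)| ‖e‖ ≤ √(C₂ log(C₁/m₀)) · √(T - t)`. Proof: co-moving bridge
(`isDriftHeatSolutionOn_comoving`) + the tree's `IsDriftHeatSolutionOn.kernel_lower_bound` with
ZERO drift, weight `h = L · (bump of radii √(s/2)/2, √(s/2) about x₀ + D(t')e)` below `G(t')` by
the LOWER bound, radius `ρ → ∞`; the transported mass lands at `x₀ - (D(t) - D(t')) e` at time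
`t`, where the UPPER bound is evaluated. No uniqueness of adapted kernels is used. -/
theorem comparable_displacement_bound (hν : 0 < ν) (hS : Ioo t₀ T ⊆ S)
    (hK : IsAdaptedBackwardKernel ν (uniformVel a e) S T x₀ G)
    (hD : ∀ t ∈ Ioo t₀ T, HasDerivAt D (-a t) t)
    {c₁ c₂ C₁ C₂ : ℝ} (hc₁ : 0 < c₁) (hc₂ : 0 < c₂)
    (hlow : ∀ t ∈ Ioo t₀ T, ∀ x,
      c₁ * (T - t) ^ (-(3 : ℝ) / 2) * Real.exp (-(‖x - x₀‖ ^ 2) / (c₂ * (T - t))) ≤ G t x)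
    (hup : ∀ t ∈ Ioo t₀ T, ∀ x,
      G t x ≤ C₁ * (T - t) ^ (-(3 : ℝ) / 2) * Real.exp (-(‖x - x₀‖ ^ 2) / (C₂ * (T - t))))
    {t : ℝ} (ht : t ∈ Ioo t₀ T) :
    dispConst ν c₁ c₂ * Real.exp ((D t - D ((t + T) / 2)) ^ 2 * ‖e‖ ^ 2 / (C₂ * (T - t))) ≤ C₁ := by
  -- times and ages
  set s : ℝ := T - t with hsdef
  have hs : 0 < s := sub_pos.2 ht.2
  set t' : ℝ := (t + T) / 2 with ht'def
  have hTt' : T - t' = s / 2 := by rw [ht'def, hsdef]; ring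
  have ht' : t' ∈ Ioo t₀ T := ⟨by rw [ht'def]; linarith [ht.1, ht.2], by rw [ht'def]; linarith [ht.2]⟩
  set σT : ℝ := ν * s with hσT
  set σb : ℝ := ν * (s / 2) with hσb
  have hσT0 : 0 < σT := mul_pos hν hs
  have hσb0 : 0 < σb := mul_pos hν (by positivity)
  have hσbT : σb < σT := by rw [hσT, hσb]; nlinarith
  have hσTmem : σT ∈ Ioo 0 (ν * (T - t₀)) :=
    ⟨hσT0, by rw [hσT]; exact mul_lt_mul_of_pos_left (by rw [hsdef]; linarith [ht.1]) hν⟩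
  have hIcc : Icc σb σT ⊆ Ioo 0 (ν * (T - t₀)) := fun τ hτ => ⟨hσb0.trans_le hτ.1, hτ.2.trans_lt hσTmem.2⟩
  have htimeT : T - σT / ν = t := by rw [hσT, hsdef]; field_simp; ring
  have htimeb : T - σb / ν = t' := by rw [hσb, ht'def, hsdef]; field_simp; ring
  have hσdiff : σT - σb = ν * s / 2 := by rw [hσT, hσb]; ring
  have hσdiff0 : 0 < σT - σb := by linarith
  -- the co-moving solution
  set v := comoving ν T e D G with hv_def
  have hv := isDriftHeatSolutionOn_comoving hν hS hK hD
  -- the weight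
  set c : ℝ³ := x₀ + D t' • e with hc
  set rs : ℝ := Real.sqrt (s / 2) with hrs_def
  have hrs : 0 < rs := Real.sqrt_pos.2 (by positivity)
  have hrs2 : rs ^ 2 = s / 2 := Real.sq_sqrt (by positivity)
  let ψ : ContDiffBump c := ⟨rs / 2, rs, by positivity, by linarith⟩
  set L : ℝ := c₁ * (s / 2) ^ (-(3 : ℝ) / 2) * Real.exp (-(1 / c₂)) with hL_def
  have hL : 0 < L := by positivity
  set h : ℝ³ → ℝ := fun y => L * ψ y with hh_def
  have hh : Continuous h := continuous_const.mul ψ.continuous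
  have h0 : ∀ z, 0 ≤ h z := fun z => mul_nonneg hL.le ψ.nonneg
  have hhs : tsupport h ⊆ closedBall c rs :=
    (tsupport_mul_subset_right (f := fun _ => L) (g := fun y => ψ y)).trans ψ.tsupport_eq.le
  -- the weight lies below `v(σb) = G(t', · - D(t') e)` (LOWER comparability bound)
  have hhu : ∀ x, h x ≤ v σb x := by
    intro x
    have hvx : v σb x = G t' (x - D t' • e) := by
      simp only [hv_def, comoving_apply, htimeb]
    rw [hvx]
    by_cases hx : dist x c < rs
    · have h1 : h x ≤ L := by
        have := mul_le_mul_of_nonneg_left (ψ.le_one (x := x)) hL.le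
        simpa [hh_def] using this
      refine h1.trans (le_trans ?_ (hlow t' ht' (x - D t' • e)))
      rw [hTt']
      have hdist : ‖x - D t' • e - x₀‖ ^ 2 ≤ s / 2 := by
        have : x - D t' • e - x₀ = x - c := by rw [hc]; abel
        rw [this, ← hrs2, ← dist_eq_norm]
        exact pow_le_pow_left₀ dist_nonneg hx.le 2
      have hexp : -(1 / c₂) ≤ -(‖x - D t' • e - x₀‖ ^ 2) / (c₂ * (s / 2)) := by
        rw [neg_div, neg_le_neg_iff, div_le_div_iff₀ (by positivity) hc₂]
        nlinarith [hdist, hc₂.le]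
      exact mul_le_mul_of_nonneg_left (Real.exp_le_exp.2 hexp) (by positivity)
    · have : ψ x = 0 := ψ.zero_of_le_dist (not_lt.1 hx)
      have h1 : h x = 0 := by simp [hh_def, this]
      rw [h1]
      exact (hK.pos t' (hS ht') _).le
  -- mass of the weight
  have hmass : L * ((rs / 2) ^ 3 * V₁) ≤ ∫ z, h z := by
    have h1 : ∫ z, h z = L * ∫ z, ψ z := integral_const_mul _ _
    have h2 := ψ.measure_closedBall_le_integral (μ := (volume : Measure ℝ³))
    have h3 : (volume : Measure ℝ³).real (closedBall c (rs / 2)) = (rs / 2) ^ 3 * V₁ := by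
      rw [Measure.addHaar_real_closedBall' volume c (by positivity : (0 : ℝ) ≤ rs / 2),
        finrank_euclideanSpace_fin]
      rfl
    rw [h1]
    refine mul_le_mul_of_nonneg_left ?_ hL.le
    rw [← h3]
    exact h2
  -- the transported lower bound at `(σT, c)`, for every large radius `ρ`
  have main : ∀ ρ : ℝ, rs + Real.sqrt (6 * (σT - σb) + 1) ≤ ρ →
      (∫ z, h z) * (kSubLow 3 0 (0 + rs) (σT - σb) - gaussTail 3 (ρ - rs) (σT - σb)) ≤ v σT c := by
    intro ρ hρ
    have hsq1 : 0 < Real.sqrt (6 * (σT - σb) + 1) := Real.sqrt_pos.2 (by linarith)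
    have hrsρ : rs < ρ := by linarith
    have hroom : 2 * (Module.finrank ℝ ℝ³ : ℝ) * (σT - σb) < (ρ - rs) ^ 2 := by
      rw [finrank_euclideanSpace_fin, Nat.cast_ofNat]
      have h1 : Real.sqrt (6 * (σT - σb) + 1) ≤ ρ - rs := by linarith
      have h2 := pow_le_pow_left₀ hsq1.le h1 2
      rw [Real.sq_sqrt (by linarith)] at h2
      linarith
    have hposρ : ∀ τ ∈ Icc σb σT, ∀ x : ℝ³, ‖x - c‖ = ρ → 0 ≤ v τ x := fun τ hτ x _ =>
      (hK.pos _ (hS (time_mem_Ioo_of_age hν (hIcc hτ))) _).le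
    have key := hv.kernel_lower_bound isOpen_univ le_rfl (c := c) (re := 0) hrs hrsρ
      (hrs.trans hrsρ).le hIcc (subset_univ _) hroom hposρ hh h0 hhs
      (fun x _ => hhu x) σT ⟨hσbT, le_rfl⟩ c (mem_closedBall_self le_rfl)
    rw [finrank_euclideanSpace_fin, Nat.cast_ofNat] at key
    exact key
  -- let `ρ → ∞`
  set m : ℝ := ∫ z, h z with hm
  set k : ℝ := kSubLow 3 0 (0 + rs) (σT - σb) with hk_def
  have hlim : Tendsto (fun ρ : ℝ => m * (k - gaussTail 3 (ρ - rs) (σT - σb))) atTop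
      (𝓝 (m * (k - 0))) :=
    (((tendsto_gaussTail_atTop 3 hσdiff0).comp (tendsto_atTop_add_const_right atTop (-rs)
      tendsto_id)).const_sub k).const_mul m
  have hmk : m * k ≤ v σT c := by
    have := le_of_tendsto hlim (Filter.eventually_atTop.2 ⟨_, fun ρ hρ => main ρ hρ⟩)
    simpa using this
  -- the value of `k`
  have hk : k = (2 * Real.pi * ν) ^ (-(3 : ℝ) / 2) * s ^ (-(3 : ℝ) / 2) * Real.exp (-(1 / (4 * ν))) := by
    have hdk : dkTilt 3 0 (0 + rs) (σT - σb) = 0 := by simp [dkTilt]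
    have h1 : k = (4 * Real.pi * (σT - σb)) ^ (-(3 : ℝ) / 2) *
        Real.exp (-(0 + rs) ^ 2 / (4 * (σT - σb))) := by
      rw [hk_def, kSubLow, hdk, neg_zero, Real.exp_zero, mul_one]
    have h2 : -(s / 2) / (4 * (ν * s / 2)) = -(1 / (4 * ν)) := by field_simp
    rw [h1, zero_add, hrs2, hσdiff, show 4 * Real.pi * (ν * s / 2) = (2 * Real.pi * ν) * s by ring,
      Real.mul_rpow (by positivity) hs.le, h2]
  -- `m k ≥ dispConst · s^{-3/2}`
  have hsq : (s / 2) ^ (-(3 : ℝ) / 2) * rs ^ 3 = 1 := by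
    have hx : 0 < s / 2 := by positivity
    rw [hrs_def, Real.sqrt_eq_rpow (s / 2), ← Real.rpow_natCast _ 3, ← Real.rpow_mul hx.le,
      ← Real.rpow_add hx]
    norm_num
  have hlow' : dispConst ν c₁ c₂ * s ^ (-(3 : ℝ) / 2) ≤ m * k := by
    have hkpos : 0 < k := by rw [hk]; positivity
    have h1 : L * ((rs / 2) ^ 3 * V₁) * k ≤ m * k := mul_le_mul_of_nonneg_right hmass hkpos.le
    have h2 : L * ((rs / 2) ^ 3 * V₁) * k = dispConst ν c₁ c₂ * s ^ (-(3 : ℝ) / 2) := by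
      rw [hk, hL_def, dispConst]
      have : (rs / 2) ^ 3 = rs ^ 3 / 8 := by ring
      rw [this]
      have h3 : c₁ * (s / 2) ^ (-(3 : ℝ) / 2) * Real.exp (-(1 / c₂)) * (rs ^ 3 / 8 * V₁) =
          c₁ * Real.exp (-(1 / c₂)) * (V₁ / 8) * ((s / 2) ^ (-(3 : ℝ) / 2) * rs ^ 3) := by ring
      rw [h3, hsq]
      ring
    linarith
  -- the UPPER comparability bound at the landing point
  have hvT : v σT c = G t (x₀ + (D t' - D t) • e) := by
    simp only [hv_def, comoving_apply, htimeT, hc]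
    congr 1
    rw [sub_smul]
    abel
  have hupT := hup t ht (x₀ + (D t' - D t) • e)
  have hnorm : ‖x₀ + (D t' - D t) • e - x₀‖ ^ 2 = (D t - D t') ^ 2 * ‖e‖ ^ 2 := by
    rw [add_sub_cancel_left, norm_smul, mul_pow, Real.norm_eq_abs, sq_abs]
    ring
  rw [hnorm] at hupT
  -- assemble
  have hspow : 0 < s ^ (-(3 : ℝ) / 2) := Real.rpow_pos_of_pos hs _
  have hchain : dispConst ν c₁ c₂ * s ^ (-(3 : ℝ) / 2) ≤
      (C₁ * Real.exp (-((D t - D t') ^ 2 * ‖e‖ ^ 2) / (C₂ * s))) * s ^ (-(3 : ℝ) / 2) := by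
    calc dispConst ν c₁ c₂ * s ^ (-(3 : ℝ) / 2) ≤ m * k := hlow'
      _ ≤ v σT c := hmk
      _ = G t (x₀ + (D t' - D t) • e) := hvT
      _ ≤ C₁ * (T - t) ^ (-(3 : ℝ) / 2) * Real.exp (-((D t - D t') ^ 2 * ‖e‖ ^ 2) / (C₂ * (T - t))) := hupT
      _ = _ := by rw [← hsdef]; ring
  have h5 := le_of_mul_le_mul_right hchain hspow
  have h6 := mul_le_mul_of_nonneg_right h5
    (Real.exp_pos ((D t - D t') ^ 2 * ‖e‖ ^ 2 / (C₂ * s))).le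
  rw [mul_assoc C₁, ← Real.exp_add, neg_div, neg_add_cancel, Real.exp_zero, mul_one] at h6
  simpa [ht'def, hsdef] using h6

/-- **The super-Type-I uniform drift admits NO Gaussian-comparable adapted kernel** on any window
(`e ≠ 0`; unconditional — cycle 1 had this only for the explicit kernel, `not_isGaussianComparable_super`).
Its dyadic displacement `D(t) - D((t+T)/2) = 4(1 - 2^{-1/4})(T - t)^{1/4}` is not parabolic:
`(D(t) - D(t'))²/(T - t) = const/√(T - t) → ∞`, against `comparable_displacement_bound`. -/
theorem super_no_comparable_adapted (hν : 0 < ν) (he : e ≠ 0) {t₀ : ℝ} (ht₀ : t₀ < T) (x₀ : ℝ³) :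
    ¬ ∃ G : ℝ → ℝ³ → ℝ, IsAdaptedBackwardKernel ν (uniformVel (superAmp T) e) (Ico t₀ T) T x₀ G ∧
        IsGaussianComparable G (Ico t₀ T) T x₀ := by
  rintro ⟨G, hK, hG⟩
  obtain ⟨c₁, c₂, C₁, C₂, hc₁, hc₂, hC₁, hC₂, hb⟩ := isGaussianComparable_iff_fin_three.1 hG
  have hbound : ∀ t ∈ Ioo t₀ T, dispConst ν c₁ c₂ *
      Real.exp ((superDisp T t - superDisp T ((t + T) / 2)) ^ 2 * ‖e‖ ^ 2 / (C₂ * (T - t))) ≤ C₁ :=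
    fun t ht => comparable_displacement_bound hν Ioo_subset_Ico_self hK
      (fun t ht => hasDerivAt_superDisp ht.2) hc₁ hc₂
      (fun t ht x => (hb t (Ioo_subset_Ico_self ht) x).1)
      (fun t ht x => (hb t (Ioo_subset_Ico_self ht) x).2) ht
  -- the exponent is `κ/√(T - t)` with `κ > 0`
  set q : ℝ := 1 - Real.sqrt (Real.sqrt (1 / 2)) with hq
  have hq0 : 0 < q := by
    have h1 : Real.sqrt (1 / 2 : ℝ) < 1 := by
      rw [Real.sqrt_lt' one_pos]; norm_num
    have h2 : Real.sqrt (Real.sqrt (1 / 2 : ℝ)) < 1 := by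
      rw [Real.sqrt_lt' one_pos]; simpa using h1
    rw [hq]; linarith
  set κ : ℝ := 16 * q ^ 2 * ‖e‖ ^ 2 / C₂ with hκ
  have hκ0 : 0 < κ := by
    have := norm_pos_iff.2 he
    positivity
  have hexpo : ∀ t < T, (superDisp T t - superDisp T ((t + T) / 2)) ^ 2 * ‖e‖ ^ 2 / (C₂ * (T - t)) =
      κ * (Real.sqrt (T - t))⁻¹ := by
    intro t ht
    have hs : 0 < T - t := sub_pos.2 ht
    have h1 : T - (t + T) / 2 = (1 / 2) * (T - t) := by ring
    have h2 : superDisp T ((t + T) / 2) = Real.sqrt (Real.sqrt (1 / 2)) * superDisp T t := by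
      simp only [superDisp]
      rw [h1, Real.sqrt_mul' _ hs.le, Real.sqrt_mul' _ (Real.sqrt_nonneg _)]
      ring
    have h3 : superDisp T t - superDisp T ((t + T) / 2) = 4 * q * Real.sqrt (Real.sqrt (T - t)) := by
      rw [h2, hq]; simp only [superDisp]; ring
    rw [h3, hκ]
    set r := Real.sqrt (T - t) with hr
    have hr0 : 0 < r := Real.sqrt_pos.2 hs
    have hr1 : r ≠ 0 := hr0.ne'
    have hC₂' : C₂ ≠ 0 := hC₂.ne'
    have h4 : Real.sqrt r ^ 2 = r := Real.sq_sqrt hr0.le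
    have h6 : (4 * q * Real.sqrt r) ^ 2 = 16 * q ^ 2 * r := by rw [mul_pow, mul_pow, h4]; ring
    have h7 : T - t = r ^ 2 := by rw [hr, Real.sq_sqrt hs.le]
    rw [h6, h7]
    field_simp
  -- hence `dispConst · exp(κ/√(T - t)) ≤ C₁` near `T`: impossible
  have hlim : Tendsto (fun t : ℝ => dispConst ν c₁ c₂ * Real.exp (κ * (Real.sqrt (T - t))⁻¹))
      (𝓝[<] T) atTop := by
    have h1 : Tendsto (fun t : ℝ => Real.sqrt (T - t)) (𝓝[<] T) (𝓝[>] 0) := by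
      refine tendsto_nhdsWithin_iff.2 ⟨?_, ?_⟩
      · have hc : Continuous (fun t : ℝ => Real.sqrt (T - t)) := by fun_prop
        have := hc.tendsto T
        simp only [sub_self, Real.sqrt_zero] at this
        exact this.mono_left nhdsWithin_le_nhds
      · filter_upwards [self_mem_nhdsWithin] with t ht
        exact Real.sqrt_pos.2 (sub_pos.2 ht)
    have h2 : Tendsto (fun t : ℝ => κ * (Real.sqrt (T - t))⁻¹) (𝓝[<] T) atTop :=
      (tendsto_inv_nhdsGT_zero.comp h1).const_mul_atTop hκ0
    exact (Real.tendsto_exp_atTop.comp h2).const_mul_atTop (dispConst_pos hν hc₁ c₂)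
  have hev := (hlim.eventually (eventually_gt_atTop C₁)).and (Ioo_mem_nhdsLT ht₀)
  obtain ⟨t, h1, h2⟩ := hev.exists
  have h3 := hbound t h2
  rw [hexpo t h2.2] at h3
  linarith

/-- **LOAD-BEARING (the rate) — UNCONDITIONAL.** The window-form linear claim WITHOUT the Type-I
rate ("every smooth divergence-free drift carries, on some final window, a Gaussian-comparable
adapted kernel at every pole") is FALSE: witness the super-Type-I uniform drift
(`super_no_comparable_adapted`). Supersedes `SuperTypeI.linear_without_rate_false_of_uniqueness`
(its Widder-uniqueness hypothesis is no longer needed). Any proof of the linear transfer target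
`C⁺` of the crux's lines must use the rate — quantitatively, by `comparable_displacement_bound`, at
least the dyadic DISPLACEMENT law `|∫ₜ^{(t+T)/2} b| = O(√(T - t))`. [folklore] -/
theorem linear_without_rate_false :
    ¬ (∀ ν : ℝ, 0 < ν → ∀ (t₁ T : ℝ), t₁ < T → ∀ b : ℝ → ℝ³ → ℝ³, IsSmoothSpaceTimeOn (Ico t₁ T) b →
        (∀ t ∈ Ico t₁ T, VectorCalculus.IsDivFree (b t)) →
        ∀ x₀ : ℝ³, ∃ t₀ ∈ Ico t₁ T, ∃ G : ℝ → ℝ³ → ℝ,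
          IsAdaptedBackwardKernel ν b (Ico t₀ T) T x₀ G ∧ IsGaussianComparable G (Ico t₀ T) T x₀) := by
  intro h
  have hcl := isClassicalNSSolutionOn_super 1 1 e₁
  obtain ⟨t₀, ht₀, G, hK, hG⟩ :=
    h 1 one_pos 0 1 one_pos (uniformVel (superAmp 1) e₁) hcl.smooth_velocity hcl.divFree 0
  exact super_no_comparable_adapted one_pos e₁_ne_zero ht₀.2 0 ⟨G, hK, hG⟩

end Displacement

end Summit.NavierStokesRegularity.NavierStokesRegularity.Theorems.AdaptedKernelExistsNegative.Comoving

end
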